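import Summits.AnomalousDissipation.AnomalousDissipation.Theorems.TaylorCertificatesFloorCertificateStubPenalisationLimit
import Summits.AnomalousDissipation.AnomalousDissipation.Theorems.TaylorCertificatesFloorCertificateStubLscEnstrophy
import Summits.AnomalousDissipation.AnomalousDissipation.Theorems.TaylorCertificatesFloorCertificateStubCylindricalCombination
import HarnessLib

/-!
# Stub `stub_penalisationLimitOn` (S1c) of line `registered`, crux `PumpedMirror.MirrorFloorTG`
# (stmt-AnomalousDissipation-15372)

THE PENALISATION LIMIT ON A CARRIER `S ∩ {|u|² ≤ ρ}`. Fix `ν > 0`, a radius `ρ`, a smooth force `f`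
on `T³` and a set `S ⊆ H = Torus.energySpace (Fin 3)` such that, for every finite level `c`, the
probability measures carried by `S ∩ {|u|² ≤ ρ}` with mean enstrophy `≤ c` form a compact subset of
`ProbabilityMeasure H`. Write `ε(μ) = ν ∫‖∇u‖² dμ`, `⟨F(u), Φ'(u)⟩` for the Navier–Stokes generator
tested against a cylindrical functional and `(u, f)` for the work. If for every `n : ℕ` an
`(n, M)`-APPROXIMATELY RELAXED statistic `μₙ` carried by `S ∩ {|u|² ≤ ρ}` is given (finite mean
enstrophy, `ε(μₙ) ≤ M`, penalised Lagrangian `ε(μₙ) + ∫⟨F,Φ'⟩dμₙ + 2θ(∫(u,f)dμₙ − ε(μₙ)) ≤ M`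
against every multiplier `(Φ, θ)` with `−n ≤ θ ≤ 0` and `|⟨F,Φ'⟩| ≤ n` on the ball), then an EXACT
relaxed stationary statistic carried by `S ∩ {|u|² ≤ ρ}` with `ε ≤ M` exists.

## Proof

Verbatim the sibling crux FloorCertificate's `stub_penalisationLimit`, with the compact set
`X_S = {μ : μ-a.e. |u|² ≤ ρ, μ-a.e. u ∈ S, ∫⁻‖∇u‖² ≤ M/ν}` (hypothesis) in place of the ball's
dissipation sublevel set: the sequence lies in `X_S`, so it has a cluster point `μ ∈ X_S`, which is
therefore again carried by `S ∩ {|u|² ≤ ρ}`; the Liouville identity (scaled tests `±kΦ` realised on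
the ball by `stub_cylindricalCombination`) and the energy inequality (flat test with `θ = −n`, lower
semicontinuity of the mean enstrophy `stub_lscEnstrophy` made real-valued by `ENNReal.truncateToReal`)
pass to the limit along the cluster filter `𝓝 μ ⊓ map μ. atTop` exactly as there.

References: Foias–Manley–Rosa–Temam, *Navier–Stokes Equations and Turbulence* (2001), Ch. IV
§1.2 (stationary statistical solutions); the line skeleton
`Cruxes/MirrorFloorTG/Lines/registered.lean`.
-/

noncomputable section

set_option linter.dupNamespace false

namespace Summit.AnomalousDissipation.AnomalousDissipation.Theorems.PumpedMirrorMirrorFloorTG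

open MeasureTheory Filter Topology UnitAddTorus
open scoped InnerProductSpace ENNReal NNReal BoundedContinuousFunction
open Literature.Analysis.FunctionSpaces Literature.Analysis.FluidPDE
open Summit.AnomalousDissipation.AnomalousDissipation.Theorems.TaylorCertificatesFloorCertificate
open Summit.AnomalousDissipation.AnomalousDissipation.Theorems.TaylorCertificatesFloorCertificate.PenalisationLimit

/-- **S1c `stub_penalisationLimitOn`** — THE PENALISATION LIMIT ON `S ∩ ball`. For `ν > 0`, a
radius `ρ`, a smooth `f` and a carrier `S` whose enstrophy sublevel sets of `S ∩ ball`-carried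
probability measures are compact: if for every `n : ℕ` an `(n, M)`-approximately relaxed statistic
carried by `S ∩ {|u|² ≤ ρ}` is given, then an EXACT relaxed stationary statistic carried by
`S ∩ {|u|² ≤ ρ}` of mean dissipation `≤ M` exists (the extra almost-sure constraint `u ∈ S` passes
to the cluster point because the compact set of the hypothesis contains the sequence).
[cite: FMRTTurbulence2001, Ch. IV §1.2] -/
theorem stub_penalisationLimitOn :
    ∀ (S : Set (Torus.energySpace (Fin 3))),
      (∀ (ρ : ℝ) (c : ℝ≥0∞), c ≠ ⊤ →
        IsCompact {μ : ProbabilityMeasure (Torus.energySpace (Fin 3)) |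
          (∀ᵐ u ∂(μ : Measure (Torus.energySpace (Fin 3))), ‖u‖ ^ 2 ≤ ρ) ∧
            (∀ᵐ u ∂(μ : Measure (Torus.energySpace (Fin 3))), u ∈ S) ∧
            Torus.ensembleEnstrophy (μ : Measure (Torus.energySpace (Fin 3))) ≤ c}) →
      ∀ (ν ρ : ℝ) (f : UnitAddTorus (Fin 3) → EuclideanSpace ℝ (Fin 3)), 0 < ν → Torus.IsSmooth f →
      ∀ (M : ℝ) (μs : ℕ → Measure (Torus.energySpace (Fin 3))),
        (∀ n : ℕ,
          IsProbabilityMeasure (μs n) ∧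
          (∀ᵐ u ∂(μs n), ‖u‖ ^ 2 ≤ ρ) ∧ (∀ᵐ u ∂(μs n), u ∈ S) ∧
          Torus.ensembleEnstrophy (μs n) < ⊤ ∧
          Integrable (fun u : Torus.energySpace (Fin 3) => Torus.pairing u.1 f) (μs n) ∧
          (∀ Φ : Torus.CylindricalTest (Fin 3),
            Integrable (fun u => Torus.nsGeneratorPairing ν f u (Φ.grad u)) (μs n)) ∧
          Torus.ensembleDissipation ν (μs n) ≤ M ∧
          ∀ (Φ : Torus.CylindricalTest (Fin 3)) (θ : ℝ), -(n : ℝ) ≤ θ → θ ≤ 0 →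
            (∀ u : Torus.energySpace (Fin 3), ‖u‖ ^ 2 ≤ ρ →
              |Torus.nsGeneratorPairing ν f u (Φ.grad u)| ≤ (n : ℝ)) →
            Torus.ensembleDissipation ν (μs n) + ∫ u, Torus.nsGeneratorPairing ν f u (Φ.grad u) ∂(μs n) +
                2 * θ * ((∫ u, Torus.pairing u.1 f ∂(μs n)) - Torus.ensembleDissipation ν (μs n)) ≤ M) →
        ∃ μ : Measure (Torus.energySpace (Fin 3)),
          (IsProbabilityMeasure μ ∧
            (∀ᵐ u ∂μ, ‖u‖ ^ 2 ≤ ρ) ∧ (∀ᵐ u ∂μ, u ∈ S) ∧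
            Torus.ensembleEnstrophy μ < ⊤ ∧
            (∀ Φ : Torus.CylindricalTest (Fin 3),
              Integrable (fun u => Torus.nsGeneratorPairing ν f u (Φ.grad u)) μ ∧
                ∫ u, Torus.nsGeneratorPairing ν f u (Φ.grad u) ∂μ = 0) ∧
            Integrable (fun u : Torus.energySpace (Fin 3) => Torus.pairing u.1 f) μ ∧
            Torus.ensembleDissipation ν μ ≤ ∫ u, Torus.pairing u.1 f ∂μ) ∧
          Torus.ensembleDissipation ν μ ≤ M := by
  intro S hcpt ν ρ f hν hf M μs h
  -- `ε ≥ 0`, hence `M ≥ 0`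
  have hDnonneg : ∀ μ' : Measure (Torus.energySpace (Fin 3)), 0 ≤ Torus.ensembleDissipation ν μ' :=
    fun μ' => mul_nonneg hν.le ENNReal.toReal_nonneg
  have hM : 0 ≤ M := (hDnonneg (μs 0)).trans (h 0).2.2.2.2.2.2.1
  -- the enstrophy level `c = M/ν`
  set c : ℝ≥0∞ := ENNReal.ofReal (M / ν)
  have hcν : 0 ≤ M / ν := div_nonneg hM hν.le
  have hEn : ∀ n, Torus.ensembleEnstrophy (μs n) ≤ c := fun n => by
    obtain ⟨-, -, -, hfin, -, -, hDle, -⟩ := h n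
    refine (ENNReal.le_ofReal_iff_toReal_le hfin.ne hcν).2 ?_
    rw [le_div_iff₀' hν]
    exact hDle
  -- lift the sequence to `ProbabilityMeasure H`
  obtain ⟨P, hP⟩ : ∃ P : ℕ → ProbabilityMeasure (Torus.energySpace (Fin 3)),
      ∀ n, (P n : Measure (Torus.energySpace (Fin 3))) = μs n :=
    ⟨fun n => ⟨μs n, (h n).1⟩, fun n => rfl⟩
  -- the compact `S`-constrained sublevel set containing the sequence
  set X : Set (ProbabilityMeasure (Torus.energySpace (Fin 3))) :=
    {μ | (∀ᵐ u ∂(μ : Measure (Torus.energySpace (Fin 3))), ‖u‖ ^ 2 ≤ ρ) ∧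
      (∀ᵐ u ∂(μ : Measure (Torus.energySpace (Fin 3))), u ∈ S) ∧
      Torus.ensembleEnstrophy (μ : Measure (Torus.energySpace (Fin 3))) ≤ c}
  have hX : IsCompact X := hcpt ρ c ENNReal.ofReal_ne_top
  have hPX : ∀ n, P n ∈ X := fun n =>
    ⟨by rw [hP n]; exact (h n).2.1, by rw [hP n]; exact (h n).2.2.1, by rw [hP n]; exact hEn n⟩
  -- a cluster point `μ ∈ X` and the cluster filter `𝓕`
  obtain ⟨μ, hμX, hcl⟩ := hX.exists_clusterPt (f := map P atTop)
    (le_principal_iff.2 (mem_map.2 (univ_mem' hPX)))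
  set 𝓕 : Filter (ProbabilityMeasure (Torus.energySpace (Fin 3))) := 𝓝 μ ⊓ map P atTop
  haveI h𝓕ne : 𝓕.NeBot := hcl.neBot
  have hT : ∀ g : Torus.energySpace (Fin 3) →ᵇ ℝ,
      Tendsto (fun μ' : ProbabilityMeasure (Torus.energySpace (Fin 3)) =>
        ∫ u, g u ∂(μ' : Measure (Torus.energySpace (Fin 3)))) 𝓕
        (𝓝 (∫ u, g u ∂(μ : Measure (Torus.energySpace (Fin 3))))) := fun g =>
    ProbabilityMeasure.tendsto_iff_forall_integral_tendsto.1 (tendsto_id'.2 inf_le_left) g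
  have hev : ∀ {p : ProbabilityMeasure (Torus.energySpace (Fin 3)) → Prop} (N : ℕ),
      (∀ n, N ≤ n → p (P n)) → ∀ᶠ μ' in 𝓕, p μ' := by
    intro p N hp
    have h2 : ∀ᶠ μ' in map P atTop, p μ' := eventually_map.2 (eventually_atTop.2 ⟨N, hp⟩)
    exact h2.filter_mono inf_le_right
  -- the limit: probability, carried by `S ∩ ball`, enstrophy `≤ M/ν`
  have hμball : ∀ᵐ u ∂(μ : Measure (Torus.energySpace (Fin 3))), ‖u‖ ^ 2 ≤ ρ := hμX.1
  have hμmem : ∀ᵐ u ∂(μ : Measure (Torus.energySpace (Fin 3))), u ∈ S := hμX.2.1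
  have hμE : Torus.ensembleEnstrophy (μ : Measure (Torus.energySpace (Fin 3))) ≤ c := hμX.2.2
  have hμfin : Torus.ensembleEnstrophy (μ : Measure (Torus.energySpace (Fin 3))) < ⊤ :=
    hμE.trans_lt ENNReal.ofReal_lt_top
  have hμD : Torus.ensembleDissipation ν (μ : Measure (Torus.energySpace (Fin 3))) ≤ M :=
    (le_div_iff₀' hν).1 (ENNReal.toReal_le_of_le_ofReal hcν hμE)
  -- (ii) the Liouville identity
  have hLiou : ∀ Φ : Torus.CylindricalTest (Fin 3),
      Integrable (fun u => Torus.nsGeneratorPairing ν f u (Φ.grad u))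
          (μ : Measure (Torus.energySpace (Fin 3))) ∧
        ∫ u, Torus.nsGeneratorPairing ν f u (Φ.grad u) ∂(μ : Measure (Torus.energySpace (Fin 3))) =
          0 := by
    intro Φ
    obtain ⟨K, hK0, hK⟩ := Torus.exists_abs_nsGeneratorPairing_grad_le ν (hf.memLp 2) Φ
    have hC : ∀ u : Torus.energySpace (Fin 3), ‖u‖ ^ 2 ≤ ρ →
        |Torus.nsGeneratorPairing ν f u (Φ.grad u)| ≤ K * (1 + |ρ|) :=
      fun u hu => (hK u).trans (mul_le_mul_of_nonneg_left (by linarith [le_abs_self ρ]) hK0)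
    obtain ⟨gb, hgb⟩ := exists_boundedContinuous_integral_eq
      (Torus.continuous_nsGeneratorPairing_grad ν hf.integrable Φ) hC
    have hIn : ∀ n, Integrable (fun u => Torus.nsGeneratorPairing ν f u (Φ.grad u)) (μs n) ∧
        ∫ u, Torus.nsGeneratorPairing ν f u (Φ.grad u) ∂(μs n) = ∫ u, gb u ∂(μs n) := fun n => by
      haveI := (h n).1
      exact hgb (μs n) (h n).2.1
    have hIμ := hgb (μ : Measure (Torus.energySpace (Fin 3))) hμball
    refine ⟨hIμ.1, ?_⟩
    rw [hIμ.2]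
    have hb : ∀ k : ℝ, 0 < k → ∀ᶠ μ' : ProbabilityMeasure (Torus.energySpace (Fin 3)) in 𝓕,
        |∫ u, gb u ∂(μ' : Measure (Torus.energySpace (Fin 3)))| ≤ M / k := by
      intro k hk
      obtain ⟨N, hN⟩ := exists_nat_ge (k * (K * (1 + |ρ|)))
      refine hev N fun n hn => ?_
      rw [hP n, ← (hIn n).2]
      have hkn : |k| * (K * (1 + |ρ|)) ≤ (n : ℝ) := by
        rw [abs_of_pos hk]
        exact hN.trans (by exact_mod_cast hn)
      have h1 := scaled_generator_le hf stub_cylindricalCombination (h n).2.1 (hDnonneg _)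
        (h n).2.2.2.2.2.2.2 (Nat.cast_nonneg n) Φ hC hkn
      have h2 := scaled_generator_le hf stub_cylindricalCombination (h n).2.1 (hDnonneg _)
        (h n).2.2.2.2.2.2.2 (Nat.cast_nonneg n) Φ hC
        (show |(-k)| * (K * (1 + |ρ|)) ≤ (n : ℝ) by rwa [abs_neg])
      rw [abs_le, neg_le, le_div_iff₀ hk, le_div_iff₀ hk]
      constructor <;> linarith
    exact eq_zero_of_tendsto_of_abs_le (hT gb) hb
  -- (iii)/(iv) the work functional and the energy inequality
  have hwc : Continuous fun u : Torus.energySpace (Fin 3) => Torus.pairing u.1 f :=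
    Torus.continuous_pairing_coe (hf.memLp 2)
  have hwB : ∀ u : Torus.energySpace (Fin 3), ‖u‖ ^ 2 ≤ ρ →
      |Torus.pairing u.1 f| ≤ (1 + |ρ|) * ‖(hf.memLp 2).toLp f‖ := by
    intro u hu
    refine (Torus.abs_pairing_coe_le (hf.memLp 2) u).trans ?_
    refine mul_le_mul_of_nonneg_right ?_ (norm_nonneg _)
    nlinarith [sq_nonneg (‖u‖ - 1), norm_nonneg u, hu, le_abs_self ρ]
  obtain ⟨wb, hwb⟩ := exists_boundedContinuous_integral_eq hwc hwB
  have hWn : ∀ n, Integrable (fun u : Torus.energySpace (Fin 3) => Torus.pairing u.1 f) (μs n) ∧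
      ∫ u, Torus.pairing u.1 f ∂(μs n) = ∫ u, wb u ∂(μs n) := fun n => by
    haveI := (h n).1
    exact hwb (μs n) (h n).2.1
  have hWμ := hwb (μ : Measure (Torus.energySpace (Fin 3))) hμball
  -- lower semicontinuity of the (truncated, real) mean enstrophy
  have hElsc : LowerSemicontinuous fun μ' : ProbabilityMeasure (Torus.energySpace (Fin 3)) =>
      ENNReal.truncateToReal c
        (Torus.ensembleEnstrophy (μ' : Measure (Torus.energySpace (Fin 3)))) :=
    (ENNReal.continuous_truncateToReal ENNReal.ofReal_ne_top).comp_lowerSemicontinuous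
      stub_lscEnstrophy (ENNReal.monotone_truncateToReal ENNReal.ofReal_ne_top)
  -- the defect `ε(μₙ) − ∫(u,f)dμₙ ≤ M/(2n)` is eventually small along `𝓕`
  have hdef : ∀ ε : ℝ, 0 < ε → ∀ᶠ μ' : ProbabilityMeasure (Torus.energySpace (Fin 3)) in 𝓕,
      ν * ENNReal.truncateToReal c
          (Torus.ensembleEnstrophy (μ' : Measure (Torus.energySpace (Fin 3)))) -
        ∫ u, wb u ∂(μ' : Measure (Torus.energySpace (Fin 3))) ≤ ε := by
    intro ε hε
    obtain ⟨N, hN⟩ := exists_nat_ge (M / (2 * ε))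
    have hN' : M ≤ (N : ℝ) * (2 * ε) := (div_le_iff₀ (by positivity)).1 hN
    refine hev (N + 1) fun n hn => ?_
    rw [ENNReal.truncateToReal_eq_toReal ENNReal.ofReal_ne_top (hPX n).2.2, hP n, ← (hWn n).2]
    have hd := energy_defect_le hf (h n).2.2.2.2.2.2.2 (Nat.cast_nonneg n)
    have hD0 := hDnonneg (μs n)
    have hNn : (N : ℝ) * (2 * ε) ≤ (n : ℝ) * (2 * ε) :=
      mul_le_mul_of_nonneg_right (by exact_mod_cast (Nat.le_succ N).trans hn) (by positivity)
    have hn1 : (1 : ℝ) ≤ n := by exact_mod_cast (Nat.le_add_left 1 N).trans hn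
    unfold Torus.ensembleDissipation at hd hD0
    refine not_lt.1 fun hcon => ?_
    have hprod := mul_lt_mul_of_pos_left hcon (by linarith : (0 : ℝ) < 2 * (n : ℝ))
    linarith
  have hmain : ν * ENNReal.truncateToReal c
      (Torus.ensembleEnstrophy (μ : Measure (Torus.energySpace (Fin 3)))) ≤
        ∫ u, wb u ∂(μ : Measure (Torus.energySpace (Fin 3))) :=
    mul_le_of_lsc_of_tendsto (x₀ := μ) hν
      (A := fun μ' : ProbabilityMeasure (Torus.energySpace (Fin 3)) =>
        ENNReal.truncateToReal c
          (Torus.ensembleEnstrophy (μ' : Measure (Torus.energySpace (Fin 3)))))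
      (W := fun μ' : ProbabilityMeasure (Torus.energySpace (Fin 3)) =>
        ∫ u, wb u ∂(μ' : Measure (Torus.energySpace (Fin 3))))
      (fun y hy => ((hElsc μ) y hy).filter_mono inf_le_left) (hT wb) hdef
  rw [ENNReal.truncateToReal_eq_toReal ENNReal.ofReal_ne_top hμE, ← hWμ.2] at hmain
  exact ⟨(μ : Measure (Torus.energySpace (Fin 3))),
    ⟨inferInstance, hμball, hμmem, hμfin, hLiou, hWμ.1, hmain⟩, hμD⟩

end Summit.AnomalousDissipation.AnomalousDissipation.Theorems.PumpedMirrorMirrorFloorTG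

end
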